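import Summits.AtomisticToContinuum.FouriersLaw.Theorems.BondHeatUncertaintyLinearResponseFTURNessFacts
import Summits.AtomisticToContinuum.FouriersLaw.Theorems.BondHeatUncertaintyLinearResponseFTURBondHeatVarianceContinuityHelper2

/-!
# Helper 3 for stub `stub_bondHeatVarianceContinuity` (crux ★ `LinearResponseFTUR`, stmt-AtomisticToContinuum-9122):
# exponential moments of the NESS family, UNIFORM in `|δ| ≤ T`

Support file for line `lebesgue-flip-duality`, stub K6b (H1 of the stub plan). For the pinned chain (all
parameters `> 0`, `N ≥ 2`), under weak-NESS uniqueness (U) and along a steady-state family `μ`, for `T > 0`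
there is `M` with `∫ e^{H/(2T)} dμ_{N, T+δ/2, T-δ/2} ≤ M` for ALL `|δ| ≤ T` (`ness_uniform_exp_moment`).
Proof: the member is the kernel-invariant Krylov–Bogoliubov state (`ness_facts`), the Lyapunov bound
`P_1 V ≤ ½ V + c` holds with `c` uniform on the temperature box `[T/2, 3T/2]²` (`uniformH2_small`, Helper 2,
plus (3.4) below the threshold), and invariance gives `∫ V dμ ≤ ½ ∫ V dμ + c`. Nothing here closes an item.
-/

noncomputable section

namespace Summit.AtomisticToContinuum.FouriersLaw.Theorems.LinearResponseFTUR

open MeasureTheory ProbabilityTheory Filter Topology Set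
open scoped NNReal ENNReal Topology
open Literature.MathematicalPhysics.KineticTheory.HeatConduction Literature.Probability.Process OscillatorChain
open Summit.AtomisticToContinuum.FouriersLaw.Theorems.BondHeatUncertainty

/-- **Uniform Lyapunov bound ⇒ uniform moment bound for invariant laws** (pinned chain, all parameters
`> 0`, `N ≥ 2`): for `T_m > 0` and `0 < θ < 1/T_m` there is `M` such that every probability measure which is
invariant under the time-one kernel at temperatures `0 < T_L, T_R ≤ T_m` and integrates `e^{θH}` has
`∫ e^{θH} dμ ≤ M` (`P_1 V ≤ ½V + c` uniformly on the box, and `∫ V dμ = ∫ P_1V dμ`). [folklore] -/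
private theorem uniform_invariant_exp_moment {ω₂ lam β γ : ℝ} (hω : 0 < ω₂) (hl : 0 < lam) (hβ : 0 < β)
    (hγ : 0 < γ) {N : ℕ} (hN : 1 < N) {Tm θ : ℝ} (hTm : 0 < Tm) (hθ : 0 < θ) (hθm : θ < 1 / Tm) :
    ∃ M : ℝ, ∀ (T_L T_R : ℝ), 0 < T_L → 0 < T_R → T_L ≤ Tm → T_R ≤ Tm →
      ∀ μ : Measure (PhaseSpace N), IsProbabilityMeasure μ →
        μ.bind ((pinnedChain ω₂ lam β γ).transitionKernel N T_L T_R 1) = μ →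
        Integrable (fun x => Real.exp (θ * (pinnedChain ω₂ lam β γ).hamiltonian N x)) μ →
        ∫ x, Real.exp (θ * (pinnedChain ω₂ lam β γ).hamiltonian N x) ∂μ ≤ M := by
  set P := pinnedChain ω₂ lam β γ with hP
  have hN0 : 0 < N := by omega
  obtain ⟨E₀, hE₀⟩ := uniformH2_small ω₂ lam β γ hω hl hβ hγ N hN Tm θ 1 hTm hθ hθm one_pos
  set c : ℝ := Real.exp (θ * γ * (Tm + Tm)) * Real.exp (θ * E₀) with hc
  have hc0 : 0 ≤ c := by positivity
  refine ⟨2 * c, fun T_L T_R hTL hTR hLm hRm μ hμ hinv hint => ?_⟩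
  set V : PhaseSpace N → ℝ := fun x => Real.exp (θ * P.hamiltonian N x) with hV
  have hVm : Measurable fun y : PhaseSpace N => ENNReal.ofReal (V y) :=
    ENNReal.measurable_ofReal.comp (Real.measurable_exp.comp
      ((pinnedChain_continuous_hamiltonian ω₂ lam β γ N).measurable.const_mul _))
  have hTmax : 0 < max T_L T_R := lt_max_of_lt_left hTL
  have hθ' : θ < 1 / max T_L T_R := hθm.trans_le (one_div_le_one_div_of_le hTmax (max_le hLm hRm))
  -- the uniform Lyapunov bound `P_1 V ≤ V/2 + c`
  have hlyap : ∀ z : PhaseSpace N, ∫⁻ y, ENNReal.ofReal (V y) ∂(P.transitionKernel N T_L T_R 1 z) ≤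
      ENNReal.ofReal (V z / 2 + c) := by
    intro z
    rw [pinnedChain_lintegral_transitionKernel hω hl.le hβ.le hγ.le N T_L T_R 1 z hVm]
    by_cases hz : E₀ ≤ P.hamiltonian N z
    · have h := hE₀ T_L T_R hTL hTR hLm hRm z hz
      simp only [NNReal.coe_one] at h ⊢
      refine h.trans (ENNReal.ofReal_le_ofReal ?_)
      simp only [hV]
      linarith only [hc0]
    · have h34 := pinnedChain_lintegral_exp_hamiltonian_solMap_le hω hl.le hβ.le hγ.le hN0 hTL hTR hθ hθ' 1 z
      refine h34.trans (ENNReal.ofReal_le_ofReal ?_)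
      have hzE : P.hamiltonian N z ≤ E₀ := le_of_lt (not_le.1 hz)
      have h1 : Real.exp (θ * γ * (T_L + T_R) * ((1 : ℝ≥0) : ℝ)) ≤ Real.exp (θ * γ * (Tm + Tm)) := by
        refine Real.exp_le_exp.2 ?_
        rw [NNReal.coe_one, mul_one]
        exact mul_le_mul_of_nonneg_left (add_le_add hLm hRm) (by positivity)
      have h2 : Real.exp (θ * P.hamiltonian N z) ≤ Real.exp (θ * E₀) :=
        Real.exp_le_exp.2 (mul_le_mul_of_nonneg_left hzE hθ.le)
      have h3 : Real.exp (θ * γ * (T_L + T_R) * ((1 : ℝ≥0) : ℝ)) * Real.exp (θ * P.hamiltonian N z) ≤ c :=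
        mul_le_mul h1 h2 (Real.exp_pos _).le (Real.exp_pos _).le
      have h4 : 0 ≤ V z / 2 := by positivity
      linarith only [h3, h4]
  -- integrate against the invariant law
  have hfin : ∫⁻ x, ENNReal.ofReal (V x) ∂μ < ∞ := by
    have h := hint.hasFiniteIntegral
    unfold HasFiniteIntegral at h
    refine lt_of_le_of_lt (lintegral_mono fun x => ?_) h
    exact le_of_eq (Real.enorm_eq_ofReal (Real.exp_pos _).le).symm
  have hkey : ∫⁻ x, ENNReal.ofReal (V x) ∂μ ≤ (∫⁻ x, ENNReal.ofReal (V x) ∂μ) / 2 + ENNReal.ofReal c := by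
    have hmeas2 : Measurable fun x : PhaseSpace N => ENNReal.ofReal (V x / 2) :=
      ENNReal.measurable_ofReal.comp ((Real.measurable_exp.comp
        ((pinnedChain_continuous_hamiltonian ω₂ lam β γ N).measurable.const_mul _)).div_const _)
    calc ∫⁻ x, ENNReal.ofReal (V x) ∂μ = ∫⁻ x, ENNReal.ofReal (V x) ∂(μ.bind (P.transitionKernel N T_L T_R 1)) := by
          rw [hinv]
      _ ≤ ∫⁻ z, ∫⁻ y, ENNReal.ofReal (V y) ∂(P.transitionKernel N T_L T_R 1 z) ∂μ :=
          Measure.lintegral_bind_le _ _ _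
      _ ≤ ∫⁻ z, ENNReal.ofReal (V z / 2 + c) ∂μ := lintegral_mono hlyap
      _ = ∫⁻ z, (ENNReal.ofReal (V z / 2) + ENNReal.ofReal c) ∂μ := by
          refine lintegral_congr fun z => ?_
          rw [ENNReal.ofReal_add (by positivity) hc0]
      _ = (∫⁻ z, ENNReal.ofReal (V z / 2) ∂μ) + ENNReal.ofReal c := by
          rw [lintegral_add_left hmeas2, lintegral_const, measure_univ, mul_one]
      _ = (∫⁻ x, ENNReal.ofReal (V x) ∂μ) / 2 + ENNReal.ofReal c := by
          congr 1
          rw [ENNReal.div_eq_inv_mul, ← lintegral_const_mul _ hVm]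
          refine lintegral_congr fun z => ?_
          rw [ENNReal.ofReal_div_of_pos two_pos, ENNReal.ofReal_ofNat, ENNReal.div_eq_inv_mul]
  -- solve the affine inequality
  set I := ∫⁻ x, ENNReal.ofReal (V x) ∂μ with hI
  have hI2 : I ≤ 2 * ENNReal.ofReal c := by
    have hIt : I ≠ ∞ := hfin.ne
    have hI2t : I / 2 ≠ ∞ := ENNReal.div_ne_top hIt (by norm_num)
    have h1 : I.toReal ≤ I.toReal / 2 + c := by
      have := ENNReal.toReal_mono (ENNReal.add_ne_top.2 ⟨hI2t, ENNReal.ofReal_ne_top⟩) hkey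
      rwa [ENNReal.toReal_add hI2t ENNReal.ofReal_ne_top, ENNReal.toReal_div,
        ENNReal.toReal_ofReal hc0] at this
    have h2 : I.toReal ≤ 2 * c := by linarith only [h1]
    calc I = ENNReal.ofReal I.toReal := (ENNReal.ofReal_toReal hIt).symm
      _ ≤ ENNReal.ofReal (2 * c) := ENNReal.ofReal_le_ofReal h2
      _ = 2 * ENNReal.ofReal c := by rw [ENNReal.ofReal_mul (by norm_num), ENNReal.ofReal_ofNat]
  have hnn : 0 ≤ᵐ[μ] V := Eventually.of_forall fun x => (Real.exp_pos _).le
  rw [integral_eq_lintegral_of_nonneg_ae hnn hint.aestronglyMeasurable]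
  have h3 : (∫⁻ x, ENNReal.ofReal (V x) ∂μ).toReal ≤ (2 * ENNReal.ofReal c).toReal :=
    ENNReal.toReal_mono (by simp [ENNReal.mul_ne_top]) hI2
  rwa [ENNReal.toReal_mul, ENNReal.toReal_ofReal hc0, ENNReal.toReal_ofNat] at h3

/-- **Exponential moments of the NESS family, uniform in `|δ| ≤ T`** (registered sub-goal of
`stub_bondHeatVarianceContinuity`, H1 of its plan): for the pinned chain (all parameters `> 0`), under
weak-NESS uniqueness and along a steady-state family `μ`, for `T > 0` and `N ≥ 2` there is `M` such that
for every `|δ| ≤ T` the member `μ N (T + δ/2) (T - δ/2)` integrates `e^{H/(2T)}` with integral `≤ M`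
(`ness_facts` + the uniform Lyapunov bound of Helper 2 on the box `[T/2, 3T/2]²`). [folklore] -/
theorem ness_uniform_exp_moment :
    ∀ ω₂ lam β γ : ℝ, 0 < ω₂ → 0 < lam → 0 < β → 0 < γ →
    (∀ (N : ℕ) (T_L T_R : ℝ), 0 < T_L → 0 < T_R → ∀ μ ν : Measure (PhaseSpace N),
      (pinnedChain ω₂ lam β γ).IsSteadyState N T_L T_R μ →
      (pinnedChain ω₂ lam β γ).IsSteadyState N T_L T_R ν → μ = ν) →
    ∀ μ : (N : ℕ) → ℝ → ℝ → Measure (PhaseSpace N),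
      (∀ (N : ℕ) (T_L T_R : ℝ), 0 < T_L → 0 < T_R →
        (pinnedChain ω₂ lam β γ).IsSteadyState N T_L T_R (μ N T_L T_R)) →
    ∀ T : ℝ, 0 < T → ∀ (N : ℕ), 2 ≤ N →
    ∃ M : ℝ, ∀ δ : ℝ, |δ| ≤ T →
      Integrable (fun x => Real.exp (1 / (2 * T) * (pinnedChain ω₂ lam β γ).hamiltonian N x))
        (μ N (T + δ / 2) (T - δ / 2)) ∧
      ∫ x, Real.exp (1 / (2 * T) * (pinnedChain ω₂ lam β γ).hamiltonian N x) ∂(μ N (T + δ / 2) (T - δ / 2)) ≤ M := by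
  intro ω₂ lam β γ hω hl hβ hγ huniq μ hμ T hT N hN
  have hN1 : 1 < N := by omega
  set Tm : ℝ := 3 * T / 2 with hTm
  have hTm0 : 0 < Tm := by positivity
  set θ : ℝ := 1 / (2 * T) with hθ
  have hθ0 : 0 < θ := by positivity
  have hθm : θ < 1 / Tm := by
    rw [hθ, hTm, div_lt_div_iff₀ (by positivity) (by positivity)]
    nlinarith only [hT]
  obtain ⟨M, hM⟩ := uniform_invariant_exp_moment hω hl hβ hγ hN1 hTm0 hθ0 hθm
  refine ⟨M, fun δ hδ => ?_⟩
  have hδ' := abs_le.1 hδ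
  have ha : 0 < T + δ / 2 := by linarith only [hT, hδ'.1]
  have hb : 0 < T - δ / 2 := by linarith only [hT, hδ'.2]
  have haM : T + δ / 2 ≤ Tm := by rw [hTm]; linarith only [hδ'.2]
  have hbM : T - δ / 2 ≤ Tm := by rw [hTm]; linarith only [hδ'.1]
  obtain ⟨hprob, hinv, hint, -⟩ := ness_facts ω₂ lam β γ hω hl hβ hγ huniq μ hμ N hN (T + δ / 2) (T - δ / 2) ha hb
  have hθ' : θ < 1 / max (T + δ / 2) (T - δ / 2) :=
    hθm.trans_le (one_div_le_one_div_of_le (lt_max_of_lt_left ha) (max_le haM hbM))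
  have hI := hint θ hθ0 hθ'
  exact ⟨hI, hM _ _ ha hb haM hbM _ hprob (hinv 1) hI⟩

end Summit.AtomisticToContinuum.FouriersLaw.Theorems.LinearResponseFTUR

end
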